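import Summits.HodgeConjecture.HodgeConjecture.Theorems.R90S6EtaOneFactorsThroughSign   -- ★ W10-i (p02): `signInvolutionAlgHom` τ, graph, uniqueness, τ on φ′₁
import Summits.HodgeConjecture.HodgeConjecture.Theorems.R90S6MacdonaldClosedFormU2      -- ★ F2′-U2 (p03): closed form of 𝒮(φ_m), ball formula; brings ★ W8-g′ recursion
import HarnessLib

/-!
# R90 · S6 «Ch. 14.1–14.5 stable TF» — WAVE 10 card W10-i (I.3): THE SIGN INVOLUTION `τ` ON THE CARTAN BASIS `φ_m = 1_{K₀ tᵐ K₀}` OF `ℋ(U(J₀,2)(E_w), K₀)`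
# (`Theorems/R90S6SignInvolutionOnBasis.lean`; DAG r5 row E1.4.4.3.x — the third factor of `η̂₁ = τ ∘ ξ̂_H ∘ ψ̂_G`)

Cell `hodgecm-mathlib`, crux H413 (`stmt-HodgeConjecture-24833`), route of record `HCCMUnconditional`; programme R90-TF, section S6 (base `R90-C14`),
seat R90-C14-p02 (g2); sequel to ★ W10-i `R90S6EtaOneFactorsThroughSign` (dealer R90-C14-plan (g2) CARD W10-i (I.3) «τ(φ′_k) in the φ′-basis from ★ F2′-U2,
(−1)^k-leading + explicit lower terms»).  Lane `--supports stmt-HodgeConjecture-24833 --as helper`; THEOREMS ONLY; letters = ★ p03's `MacdonaldRankOneU2` ∕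
`MacdonaldClosedFormU2` (`t`, `ht : (t : GL₂) = diag(ϖ, ϖ⁻¹)`, `φ_m = doubleCosetOperator K₀ (t ^ m)`, `q = √Q = Nat.sqrt #𝓀[E_w]`, `Q = #𝓀[E_w]`) at the inert
unramified place `w` (`σ_w = galAdicCompletionMap c hw`, datum `hd`), and ★ W10-i's `τ = signInvolutionAlgHom c hc1 v w hw hv`.

CONTENT.
* §1 (R.1) **`signInvolutionAlgHom_basic_mul_pow`**: `τφ₁ · τφ_m = τφ_{m+1} + (q − 1)•τφ_m + Q•τφ_{m−1}` (`m ≥ 2`) and (R.2) **`signInvolutionAlgHom_basic_mul_self`**: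
  `τφ₁ · τφ₁ = τφ₂ + (q − 1)•τφ₁ + (Q + q)•1` — ★ p03's Hecke recursions through the algebra hom `τ`; with ★ (I.3, k = 1) `τφ₁ = −φ₁ + 2(q−1)•1` and `τ 1 = 1`
  they DETERMINE every `τφ_k` recursively (same currency as p06's `b`-recursion W10-f).
* §2 (R.3) **THE CLOSED FORM (ball form)** `signInvolutionAlgHom_basic_pow`: for `m ≥ 1`, with the balls `B_i = Σ_{j ≤ i} φ_j = 1_{K₀ t^{≤ i} K₀}`,
  **`τ(φ_m) = (−1)^m φ_m + 2(q − 1) Σ_{i<m} (−1)^i q^{m−1−i} B_i`**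
  (`m = 1`: `−φ₁ + 2(q−1)`; `m = 2`: `φ₂ − 2(q−1)φ₁ + 2(q−1)²`; `m = 3`: `−φ₃ + 2(q−1)φ₂ − 2(q−1)²φ₁ + 2(q−1)(q²−q+1)`); in the `φ`-basis the coefficient of `φ_j`
  (`j < m`) is `2(q−1) Σ_{i=j}^{m−1} (−1)^i q^{m−1−i}`.
  PROOF: by the graph (★ `eq_signInvolutionAlgHom_of_graph`) it suffices that `λ_{(z,1)}(RHS) = λ_{(−z,1)}(φ_m)`; through ★ `unitaryHeckeEigencharacterAdic_eq` and
  `hd.heckeEigencharacter = laurentEvalAt ∘ 𝒮` both sides are evaluations of ★ p03's closed form `𝒮(φ_m) = q^m(x^m + x^{−m}) + (q−1)q^{m−1} V_{m−1}` and ball formula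
  `𝒮(B_i) = q^i V_i` (`V_k = Σ_{|j| ≤ k} x^j`); the identity then reduces to the parity identity of Laurent polynomials
  `V_n(−z) = (−1)^{n+1} V_n(z) + 2 Σ_{i ≤ n} (−1)^i V_i(z)` (`ball_eval_neg`, induction on `n`: both sides increase by `(−1)^{n+1}(z^{n+1} + z^{−(n+1)})`).
* §2 (R.4) **THE SHELL FORM** `signInvolutionAlgHom_basic_pow_shell`: `τ(φ_m) = (−1)^m φ_m + Σ_{j<m} (2(q−1) Σ_{i ∈ [j, m)} (−1)^i q^{m−1−i}) • φ_j` — (R.3) resummed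
  (`sum_smul_ball_swap`, any module); the coefficients E1.4.4.3 reads off.
HONEST LABEL: local spherical Hecke bookkeeping on the `(q_v + 1)`-regular tree; proves no orbital-integral identity and no printed global statement; count-neutral until
E1.4.4.3.x consumes `η̂₁ = τ ∘ ξ̂_H ∘ ψ̂_G` on the Cartan basis.  HC_CM is proved only modulo the 7 printed citations (2 remaining named inputs: hLiu418 =
stmt-HodgeConjecture-24832, h413 = stmt-HodgeConjecture-24833) until rung 0 closes; REL ≠ ★ ≠ BUILT.

## References
* [Macdonald1971] I. G. Macdonald, *Spherical functions on a group of p-adic type*, Publ. Ramanujan Inst. 2 (1971), Ch. V §3 (rank one).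
* [Rogawski1990] J. D. Rogawski, *Automorphic Representations of Unitary Groups in Three Variables*, Ann. of Math. Stud. 123 (1990), §4.9 p. 55 («`ξ̂_H(f)^∧(z) = f^∧(−z)`»).
* [CartierCorvallis1979] P. Cartier, *Representations of 𝔭-adic groups: a survey*, PSPM 33.1 (1979), §IV (4.2), Thm. 4.1, Cor. 4.2.
-/

set_option autoImplicit false
-- the mandated namespace repeats the single-problem summit's segment (`HodgeConjecture.HodgeConjecture`)
set_option linter.dupNamespace false

noncomputable section

open NumberField IsDedekindDomain
open Literature.NumberTheory.Automorphic Literature.NumberTheory.Automorphic.HermitianLattice Literature.NumberTheory.Automorphic.UnitaryGroup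
open Literature.NumberTheory.Automorphic.CartanUnique
open scoped MatrixGroups
open ValuativeRel

namespace Summit.HodgeConjecture.HodgeConjecture.R90.S6

/-! ## §0 Light-carrier bookkeeping (instantiated at the Hecke algebra by unification only) -/

/-- `f x · f y = f z + a • f u + b • f v` from `x · y = z + a • u + b • v`. [folklore] -/
private theorem algHom_mul_of_eq_add_smul_add_smul {R A B : Type*} [CommSemiring R] [Semiring A] [Semiring B] [Algebra R A] [Algebra R B]
    (f : A →ₐ[R] B) {x y z u v : A} {a b : R} (h : x * y = z + a • u + b • v) : f x * f y = f z + a • f u + b • f v := by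
  rw [← map_mul, h, map_add, map_add, map_smul, map_smul]

/-- `f x · f x = f z + a • f x + b • 1` from `x · x = z + a • x + b • 1`. [folklore] -/
private theorem algHom_mul_self_of_eq_add_smul_add_smul_one {R A B : Type*} [CommSemiring R] [Semiring A] [Semiring B] [Algebra R A] [Algebra R B]
    (f : A →ₐ[R] B) {x z : A} {a b : R} (h : x * x = z + a • x + b • 1) : f x * f x = f z + a • f x + b • 1 := by
  rw [← map_mul, h, map_add, map_add, map_smul, map_smul, map_one]

/-- `f (a • x + Σ_i c_i • y_i) = a • f x + Σ_i c_i • f (y_i)`. [folklore] -/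
private theorem algHom_apply_smul_add_sum_smul {R A B ι : Type*} [CommSemiring R] [Semiring A] [Semiring B] [Algebra R A] [Algebra R B]
    (f : A →ₐ[R] B) (a : R) (x : A) (s : Finset ι) (c : ι → R) (y : ι → A) :
    f (a • x + ∑ i ∈ s, c i • y i) = a • f x + ∑ i ∈ s, c i • f (y i) := by
  simp only [map_add, map_smul, map_sum]

/-- `f (Σ_i y_i) = Σ_i f (y_i)`. [folklore] -/
private theorem algHom_apply_sum {R A B ι : Type*} [CommSemiring R] [Semiring A] [Semiring B] [Algebra R A] [Algebra R B]
    (f : A →ₐ[R] B) (s : Finset ι) (y : ι → A) : f (∑ i ∈ s, y i) = ∑ i ∈ s, f (y i) :=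
  map_sum f y s

/-! ## §0′ Evaluation of the line monomials `x^{ℓ_a}` at `(y, 1)` and the parity identity of the balls -/

/-- `x^{ℓ_a}(y, 1) = y^a` (`ℓ_a = (a, −a)`). [cite: CartierCorvallis1979, §IV (4.2)] -/
private theorem laurentEvalAt_pair_one_single_line (y : ℂˣ) (a : ℤ) :
    laurentEvalAt ![y, 1] (AddMonoidAlgebra.single (fun i : Fin 2 => a * (1 - 2 * (i : ℕ))) (1 : ℂ)) = (y : ℂ) ^ a := by
  rw [laurentEvalAt_single, one_mul, Fin.prod_univ_two]
  simp only [Matrix.cons_val_zero, Matrix.cons_val_one, Fin.val_zero, Fin.val_one, Nat.cast_zero, Nat.cast_one, mul_zero, sub_zero, mul_one,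
    Units.val_one, one_zpow]

/-- `x^{ℓ_n}(y, 1) = y^n` for `n : ℕ`. [folklore] -/
private theorem laurentEvalAt_pair_one_single_line_nat (y : ℂˣ) (n : ℕ) :
    laurentEvalAt ![y, 1] (AddMonoidAlgebra.single (fun i : Fin 2 => (n : ℤ) * (1 - 2 * (i : ℕ))) (1 : ℂ)) = (y : ℂ) ^ n := by
  rw [laurentEvalAt_pair_one_single_line, zpow_natCast]

/-- `x^{ℓ_{−n}}(y, 1) = (y^n)⁻¹` for `n : ℕ`. [folklore] -/
private theorem laurentEvalAt_pair_one_single_line_neg_nat (y : ℂˣ) (n : ℕ) :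
    laurentEvalAt ![y, 1] (AddMonoidAlgebra.single (fun i : Fin 2 => (-(n : ℤ)) * (1 - 2 * (i : ℕ))) (1 : ℂ)) = ((y : ℂ) ^ n)⁻¹ := by
  rw [laurentEvalAt_pair_one_single_line, zpow_neg, zpow_natCast]

/-- `x^{ℓ_{k+1}}(y, 1) = y^{k+1}`. [folklore] -/
private theorem laurentEvalAt_pair_one_single_line_succ (y : ℂˣ) (k : ℕ) :
    laurentEvalAt ![y, 1] (AddMonoidAlgebra.single (fun i : Fin 2 => ((k : ℤ) + 1) * (1 - 2 * (i : ℕ))) (1 : ℂ)) = (y : ℂ) ^ (k + 1) := by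
  rw [show ((k : ℤ) + 1) = ((k + 1 : ℕ) : ℤ) by push_cast; ring, laurentEvalAt_pair_one_single_line_nat]

/-- `x^{ℓ_{−(k+1)}}(y, 1) = (y^{k+1})⁻¹`. [folklore] -/
private theorem laurentEvalAt_pair_one_single_line_neg_succ (y : ℂˣ) (k : ℕ) :
    laurentEvalAt ![y, 1] (AddMonoidAlgebra.single (fun i : Fin 2 => (-((k : ℤ) + 1)) * (1 - 2 * (i : ℕ))) (1 : ℂ)) = ((y : ℂ) ^ (k + 1))⁻¹ := by
  rw [show ((k : ℤ) + 1) = ((k + 1 : ℕ) : ℤ) by push_cast; ring, laurentEvalAt_pair_one_single_line_neg_nat]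

/-- `((−1)^n x)⁻¹ = (−1)^n x⁻¹`. [folklore] -/
private theorem inv_neg_one_pow_mul (x : ℂ) (n : ℕ) : ((-1) ^ n * x)⁻¹ = (-1) ^ n * x⁻¹ := by
  rw [mul_inv, ← inv_pow, inv_neg_one]

/-- **The parity identity of the balls** `V_n(y) = 1 + Σ_{j<n} (y^{j+1} + y^{−(j+1)}) = Σ_{|j| ≤ n} y^j`:
`V_n(−z) = (−1)^{n+1} V_n(z) + 2 Σ_{i ≤ n} (−1)^i V_i(z)` (induction on `n`; both sides grow by `(−1)^{n+1}(z^{n+1} + z^{−(n+1)})`). [cite: Macdonald1971, Ch. V §3] -/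
private theorem ball_eval_neg (z : ℂ) (n : ℕ) :
    (1 + ∑ j ∈ Finset.range n, ((-1) ^ (j + 1) * z ^ (j + 1) + (-1) ^ (j + 1) * (z ^ (j + 1))⁻¹)) =
      (-1) ^ (n + 1) * (1 + ∑ j ∈ Finset.range n, (z ^ (j + 1) + (z ^ (j + 1))⁻¹)) +
        2 * ∑ i ∈ Finset.range (n + 1), (-1) ^ i * (1 + ∑ j ∈ Finset.range i, (z ^ (j + 1) + (z ^ (j + 1))⁻¹)) := by
  induction n with
  | zero => norm_num
  | succ n ih =>
    rw [Finset.sum_range_succ _ (n + 1), Finset.sum_range_succ (fun j => (z ^ (j + 1) + (z ^ (j + 1))⁻¹)) n,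
      Finset.sum_range_succ (fun j => ((-1) ^ (j + 1) * z ^ (j + 1) + (-1) ^ (j + 1) * (z ^ (j + 1))⁻¹)) n]
    linear_combination ih

/-- **Ball-to-shell resummation** in any module: `Σ_{i<m} c_i • (Σ_{j≤i} φ_j) = Σ_{j<m} (Σ_{i=j}^{m−1} c_i) • φ_j`. [folklore] -/
private theorem sum_smul_ball_swap {R M : Type*} [Semiring R] [AddCommMonoid M] [Module R M] (c : ℕ → R) (φ : ℕ → M) (m : ℕ) :
    ∑ i ∈ Finset.range m, c i • ∑ j ∈ Finset.range (i + 1), φ j = ∑ j ∈ Finset.range m, (∑ i ∈ Finset.Ico j m, c i) • φ j := by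
  simp_rw [Finset.smul_sum, Finset.sum_smul]
  exact Finset.sum_comm' fun i j => by
    simp only [Finset.mem_range, Finset.mem_Ico]
    omega

section Basis

variable {F E : Type} [Field F] [NumberField F] [Field E] [NumberField E] [Algebra F E] [Algebra.IsQuadraticExtension F E]
  (c : E ≃ₐ[F] E) (hc1 : c ≠ 1) (v : HeightOneSpectrum (𝓞 F)) (w : PlacesOver E v) (hw : c • w.1 = w.1)
  (hv : Algebra.IsUnramifiedIn (𝓞 E) v.asIdeal)

/-! ## §1 (R.1), (R.2): the recursions through `τ` -/

/-- **(R.1) `τφ₁ · τφ_m = τφ_{m+1} + (q − 1)•τφ_m + Q•τφ_{m−1}`** (`m ≥ 2`; `q − 1` as the natural number `Nat.sqrt Q − 1`, `Q = #𝓀[E_w]`): ★ p03's Macdonald recursion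
`doubleCosetOperator_mul_pow_two` through the algebra homomorphism `τ`. [cite: Macdonald1971, Ch. V §3] [cite: Rogawski1990, §4.9 p. 55] -/
theorem signInvolutionAlgHom_basic_mul_pow {ϖ' : w.1.adicCompletion E} (hd : UnramifiedLocalConjDatum (galAdicCompletionMap (L := E) c hw) ϖ')
    (t : ↥(unitaryGroupOfForm (galAdicCompletionMap (L := E) c hw) ((StdForm.antidiagonal 2).over (w.1.adicCompletion E))))
    (ht : (t : GL (Fin 2) (w.1.adicCompletion E)) = zpowDiagGL (uniformizer_ne_zero hd.vϖ) ![(1 : ℤ), -1]) {m : ℕ} (hm : 2 ≤ m) :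
    haveI := isHeckeTriple_unitaryInt_adicCompletion c v w hw ((StdForm.antidiagonal 2).over (w.1.adicCompletion E))
    signInvolutionAlgHom c hc1 v w hw hv
          (heckeAlgebra.doubleCosetOperator (k := ℂ) (unitaryInt (galAdicCompletionMap (L := E) c hw) ((StdForm.antidiagonal 2).over (w.1.adicCompletion E))) t) *
        signInvolutionAlgHom c hc1 v w hw hv
          (heckeAlgebra.doubleCosetOperator (k := ℂ) (unitaryInt (galAdicCompletionMap (L := E) c hw) ((StdForm.antidiagonal 2).over (w.1.adicCompletion E))) (t ^ m)) =
      signInvolutionAlgHom c hc1 v w hw hv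
          (heckeAlgebra.doubleCosetOperator (k := ℂ) (unitaryInt (galAdicCompletionMap (L := E) c hw) ((StdForm.antidiagonal 2).over (w.1.adicCompletion E)))
            (t ^ (m + 1))) +
        ((Nat.sqrt (Nat.card (Valued.ResidueField (w.1.adicCompletion E))) - 1 : ℕ) : ℂ) •
          signInvolutionAlgHom c hc1 v w hw hv
            (heckeAlgebra.doubleCosetOperator (k := ℂ) (unitaryInt (galAdicCompletionMap (L := E) c hw) ((StdForm.antidiagonal 2).over (w.1.adicCompletion E)))
              (t ^ m)) +
        ((Nat.card (Valued.ResidueField (w.1.adicCompletion E)) : ℕ) : ℂ) •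
          signInvolutionAlgHom c hc1 v w hw hv
            (heckeAlgebra.doubleCosetOperator (k := ℂ) (unitaryInt (galAdicCompletionMap (L := E) c hw) ((StdForm.antidiagonal 2).over (w.1.adicCompletion E)))
              (t ^ (m - 1))) := by
  haveI := isHeckeTriple_unitaryInt_adicCompletion c v w hw ((StdForm.antidiagonal 2).over (w.1.adicCompletion E))
  haveI := finite_residueField_adicCompletion E w.1
  exact algHom_mul_of_eq_add_smul_add_smul (signInvolutionAlgHom c hc1 v w hw hv)
    (doubleCosetOperator_mul_pow_two (k := ℂ) hd (exists_galAdicCompletionMap_ne c hc1 v w hw) t ht hm)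

/-- **(R.2) `τφ₁ · τφ₁ = τφ₂ + (q − 1)•τφ₁ + (Q + q)•1`**: ★ p03's `doubleCosetOperator_mul_self_two` through `τ` (`τ 1 = 1`). [cite: Macdonald1971, Ch. V §3]
[cite: Rogawski1990, §4.9 p. 55] -/
theorem signInvolutionAlgHom_basic_mul_self {ϖ' : w.1.adicCompletion E} (hd : UnramifiedLocalConjDatum (galAdicCompletionMap (L := E) c hw) ϖ')
    (t : ↥(unitaryGroupOfForm (galAdicCompletionMap (L := E) c hw) ((StdForm.antidiagonal 2).over (w.1.adicCompletion E))))
    (ht : (t : GL (Fin 2) (w.1.adicCompletion E)) = zpowDiagGL (uniformizer_ne_zero hd.vϖ) ![(1 : ℤ), -1]) :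
    haveI := isHeckeTriple_unitaryInt_adicCompletion c v w hw ((StdForm.antidiagonal 2).over (w.1.adicCompletion E))
    signInvolutionAlgHom c hc1 v w hw hv
          (heckeAlgebra.doubleCosetOperator (k := ℂ) (unitaryInt (galAdicCompletionMap (L := E) c hw) ((StdForm.antidiagonal 2).over (w.1.adicCompletion E))) t) *
        signInvolutionAlgHom c hc1 v w hw hv
          (heckeAlgebra.doubleCosetOperator (k := ℂ) (unitaryInt (galAdicCompletionMap (L := E) c hw) ((StdForm.antidiagonal 2).over (w.1.adicCompletion E))) t) =
      signInvolutionAlgHom c hc1 v w hw hv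
          (heckeAlgebra.doubleCosetOperator (k := ℂ) (unitaryInt (galAdicCompletionMap (L := E) c hw) ((StdForm.antidiagonal 2).over (w.1.adicCompletion E)))
            (t ^ 2)) +
        ((Nat.sqrt (Nat.card (Valued.ResidueField (w.1.adicCompletion E))) - 1 : ℕ) : ℂ) •
          signInvolutionAlgHom c hc1 v w hw hv
            (heckeAlgebra.doubleCosetOperator (k := ℂ) (unitaryInt (galAdicCompletionMap (L := E) c hw) ((StdForm.antidiagonal 2).over (w.1.adicCompletion E))) t) +
        ((Nat.card (Valued.ResidueField (w.1.adicCompletion E)) + Nat.sqrt (Nat.card (Valued.ResidueField (w.1.adicCompletion E))) : ℕ) : ℂ) • 1 := by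
  haveI := isHeckeTriple_unitaryInt_adicCompletion c v w hw ((StdForm.antidiagonal 2).over (w.1.adicCompletion E))
  haveI := finite_residueField_adicCompletion E w.1
  exact algHom_mul_self_of_eq_add_smul_add_smul_one (signInvolutionAlgHom c hc1 v w hw hv)
    (doubleCosetOperator_mul_self_two (k := ℂ) hd (exists_galAdicCompletionMap_ne c hc1 v w hw) t ht)

/-! ## §2 (R.3): the closed form of `τ(φ_m)` in the Cartan basis (ball form) -/

set_option maxHeartbeats 400000 in
/-- **(R.3) THE SIGN INVOLUTION ON THE CARTAN BASIS** of `ℋ(U(J₀,2)(E_w), K₀)` (`m ≥ 1`, `q = √Q = Nat.sqrt #𝓀[E_w]`, `B_i = Σ_{j ≤ i} φ_j` the ball of radius `i`):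
**`τ(φ_m) = (−1)^m φ_m + Σ_{i<m} (2(q − 1)(−1)^i q^{m−1−i}) • B_i`** — `(−1)^m`-leading with explicit lower terms; coefficient of `φ_j` (`j < m`) =
`2(q−1) Σ_{i=j}^{m−1} (−1)^i q^{m−1−i}` (`m = 1`: ★ (I.3) `−φ₁ + 2(q−1)`; `m = 2`: `φ₂ − 2(q−1)φ₁ + 2(q−1)²`).  By the graph of `τ` (★ `eq_signInvolutionAlgHom_of_graph`), ★ p03's
closed form `satakeTransform_doubleCosetOperator_pow_two_eq` and ball formula `sum_satakeTransform_doubleCosetOperator_pow_two`, and the parity identity `ball_eval_neg`.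
[cite: Macdonald1971, Ch. V §3] [cite: Rogawski1990, §4.9 p. 55] [cite: CartierCorvallis1979, §IV Thm. 4.1, Cor. 4.2] -/
theorem signInvolutionAlgHom_basic_pow {ϖ' : w.1.adicCompletion E} (hd : UnramifiedLocalConjDatum (galAdicCompletionMap (L := E) c hw) ϖ')
    (t : ↥(unitaryGroupOfForm (galAdicCompletionMap (L := E) c hw) ((StdForm.antidiagonal 2).over (w.1.adicCompletion E))))
    (ht : (t : GL (Fin 2) (w.1.adicCompletion E)) = zpowDiagGL (uniformizer_ne_zero hd.vϖ) ![(1 : ℤ), -1]) {m : ℕ} (hm : 1 ≤ m) :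
    haveI := isHeckeTriple_unitaryInt_adicCompletion c v w hw ((StdForm.antidiagonal 2).over (w.1.adicCompletion E))
    signInvolutionAlgHom c hc1 v w hw hv
        (heckeAlgebra.doubleCosetOperator (k := ℂ) (unitaryInt (galAdicCompletionMap (L := E) c hw) ((StdForm.antidiagonal 2).over (w.1.adicCompletion E))) (t ^ m)) =
      ((-1 : ℂ) ^ m) •
          heckeAlgebra.doubleCosetOperator (k := ℂ) (unitaryInt (galAdicCompletionMap (L := E) c hw) ((StdForm.antidiagonal 2).over (w.1.adicCompletion E))) (t ^ m) +
        ∑ i ∈ Finset.range m,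
          (2 * ((Nat.sqrt (Nat.card (Valued.ResidueField (w.1.adicCompletion E))) : ℂ) - 1) * (-1) ^ i *
              (Nat.sqrt (Nat.card (Valued.ResidueField (w.1.adicCompletion E))) : ℂ) ^ (m - 1 - i)) •
            ∑ j ∈ Finset.range (i + 1),
              heckeAlgebra.doubleCosetOperator (k := ℂ) (unitaryInt (galAdicCompletionMap (L := E) c hw) ((StdForm.antidiagonal 2).over (w.1.adicCompletion E)))
                (t ^ j) := by
  haveI := isHeckeTriple_unitaryInt_adicCompletion c v w hw ((StdForm.antidiagonal 2).over (w.1.adicCompletion E))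
  haveI := finite_residueField_adicCompletion E w.1
  have hσ := exists_galAdicCompletionMap_ne c hc1 v w hw
  obtain ⟨n, rfl⟩ := Nat.exists_eq_add_of_le' hm
  -- TERM-MODE DISCIPLINE: no `rw`/`simp` ever sees two eigencharacter ∕ Satake applications with different heavy arguments, nor `z` against `−z`
  -- (`kabstract`'s `isDefEq` on this function carrier and on `ℂˣ` negation are heartbeat sinks); all rewriting happens in `ℂ[ℤ²]` and `ℂ`.
  -- (1) the Satake transforms: ★ closed form of `𝒮(φ_{n+1})`, ★ ball formula `𝒮(B_i) = q^i V_i`, and `𝒮` through the linear combination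
  have hT := satakeTransform_doubleCosetOperator_pow_succ_two_eq hd hσ t ht n
  have hBall : ∀ i : ℕ, hd.satakeTransform (∑ j ∈ Finset.range (i + 1),
      heckeAlgebra.doubleCosetOperator (k := ℂ) (unitaryInt (galAdicCompletionMap (L := E) c hw) ((StdForm.antidiagonal 2).over (w.1.adicCompletion E)))
        (t ^ j)) =
      ((Nat.sqrt (Nat.card (Valued.ResidueField (w.1.adicCompletion E))) : ℂ) ^ i) •
        (1 + ∑ j ∈ Finset.range i, (AddMonoidAlgebra.single (fun l : Fin 2 => ((j : ℤ) + 1) * (1 - 2 * (l : ℕ))) (1 : ℂ) +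
          AddMonoidAlgebra.single (fun l : Fin 2 => (-((j : ℤ) + 1)) * (1 - 2 * (l : ℕ))) (1 : ℂ))) := fun i =>
    (algHom_apply_sum hd.satakeTransform _ _).trans (sum_satakeTransform_doubleCosetOperator_pow_two hd hσ t ht i)
  have hS := (algHom_apply_smul_add_sum_smul hd.satakeTransform ((-1 : ℂ) ^ (n + 1))
    (heckeAlgebra.doubleCosetOperator (k := ℂ) (unitaryInt (galAdicCompletionMap (L := E) c hw) ((StdForm.antidiagonal 2).over (w.1.adicCompletion E)))
      (t ^ (n + 1)))
    (Finset.range (n + 1))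
    (fun i => 2 * ((Nat.sqrt (Nat.card (Valued.ResidueField (w.1.adicCompletion E))) : ℂ) - 1) * (-1) ^ i *
      (Nat.sqrt (Nat.card (Valued.ResidueField (w.1.adicCompletion E))) : ℂ) ^ (n + 1 - 1 - i))
    (fun i => ∑ j ∈ Finset.range (i + 1),
      heckeAlgebra.doubleCosetOperator (k := ℂ) (unitaryInt (galAdicCompletionMap (L := E) c hw) ((StdForm.antidiagonal 2).over (w.1.adicCompletion E)))
        (t ^ j))).trans
    (congrArg₂ (fun X Y => ((-1 : ℂ) ^ (n + 1)) • X + Y) hT (Finset.sum_congr rfl fun i _ => congrArg (_ • ·) (hBall i)))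
  -- (2) the graph of `τ`: both adic eigencharacters through the datum `hd` (`λ_β = ev_β ∘ 𝒮` is `rfl`), as a term chain
  refine (eq_signInvolutionAlgHom_of_graph c hc1 v w hw hv _ _ fun z => ?_).symm
  refine (DFunLike.congr_fun (unitaryHeckeEigencharacterAdic_eq c hc1 v w hw hv hd ![z, 1]) _).trans
    (((hd.heckeEigencharacter_apply ![z, 1] _).trans (congrArg (laurentEvalAt ![z, 1]) hS)).trans (Eq.trans ?_
      ((DFunLike.congr_fun (unitaryHeckeEigencharacterAdic_eq c hc1 v w hw hv hd ![-z, 1]) _).trans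
        ((hd.heckeEigencharacter_apply ![-z, 1] _).trans (congrArg (laurentEvalAt ![-z, 1]) hT))).symm))
  -- (3) evaluate at `(z, 1)` and `(−z, 1)`: everything below lives in `ℂ`
  simp only [map_add, map_smul, map_sum, map_one, laurentEvalAt_pair_one_single_line_succ, laurentEvalAt_pair_one_single_line_neg_succ, smul_eq_mul,
    Units.val_neg, neg_pow (z : ℂ), inv_neg_one_pow_mul]
  -- `q^{n−i} q^i = q^n` inside the outer sum, then the parity identity of the balls
  have hsum : (∑ i ∈ Finset.range (n + 1),
      2 * ((Nat.sqrt (Nat.card (Valued.ResidueField (w.1.adicCompletion E))) : ℂ) - 1) * (-1) ^ i *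
          (Nat.sqrt (Nat.card (Valued.ResidueField (w.1.adicCompletion E))) : ℂ) ^ (n + 1 - 1 - i) *
        ((Nat.sqrt (Nat.card (Valued.ResidueField (w.1.adicCompletion E))) : ℂ) ^ i *
          (1 + ∑ j ∈ Finset.range i, ((z : ℂ) ^ (j + 1) + ((z : ℂ) ^ (j + 1))⁻¹)))) =
      2 * ((Nat.sqrt (Nat.card (Valued.ResidueField (w.1.adicCompletion E))) : ℂ) - 1) *
          (Nat.sqrt (Nat.card (Valued.ResidueField (w.1.adicCompletion E))) : ℂ) ^ n *
        ∑ i ∈ Finset.range (n + 1), (-1) ^ i * (1 + ∑ j ∈ Finset.range i, ((z : ℂ) ^ (j + 1) + ((z : ℂ) ^ (j + 1))⁻¹)) := by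
    rw [Finset.mul_sum]
    refine Finset.sum_congr rfl fun i hi => ?_
    rw [Nat.add_sub_cancel, ← pow_sub_mul_pow (Nat.sqrt (Nat.card (Valued.ResidueField (w.1.adicCompletion E))) : ℂ) (Nat.lt_succ_iff.1 (Finset.mem_range.1 hi))]
    ring
  rw [hsum, ball_eval_neg (z : ℂ) n]
  ring

/-- **(R.4) THE SAME IN THE CARTAN BASIS `{φ_j}`** (`m ≥ 1`): **`τ(φ_m) = (−1)^m φ_m + Σ_{j<m} (2(q − 1) Σ_{i=j}^{m−1} (−1)^i q^{m−1−i}) • φ_j`** — the ball form (R.3)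
resummed shell by shell (`B_i = Σ_{j ≤ i} φ_j`); these are the coefficients E1.4.4.3 reads off for `η̂₁ = τ ∘ ξ̂_H ∘ ψ̂_G` on the Cartan basis.
[cite: Macdonald1971, Ch. V §3] [cite: Rogawski1990, §4.9 p. 55] -/
theorem signInvolutionAlgHom_basic_pow_shell {ϖ' : w.1.adicCompletion E} (hd : UnramifiedLocalConjDatum (galAdicCompletionMap (L := E) c hw) ϖ')
    (t : ↥(unitaryGroupOfForm (galAdicCompletionMap (L := E) c hw) ((StdForm.antidiagonal 2).over (w.1.adicCompletion E))))
    (ht : (t : GL (Fin 2) (w.1.adicCompletion E)) = zpowDiagGL (uniformizer_ne_zero hd.vϖ) ![(1 : ℤ), -1]) {m : ℕ} (hm : 1 ≤ m) :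
    haveI := isHeckeTriple_unitaryInt_adicCompletion c v w hw ((StdForm.antidiagonal 2).over (w.1.adicCompletion E))
    signInvolutionAlgHom c hc1 v w hw hv
        (heckeAlgebra.doubleCosetOperator (k := ℂ) (unitaryInt (galAdicCompletionMap (L := E) c hw) ((StdForm.antidiagonal 2).over (w.1.adicCompletion E))) (t ^ m)) =
      ((-1 : ℂ) ^ m) •
          heckeAlgebra.doubleCosetOperator (k := ℂ) (unitaryInt (galAdicCompletionMap (L := E) c hw) ((StdForm.antidiagonal 2).over (w.1.adicCompletion E))) (t ^ m) +
        ∑ j ∈ Finset.range m,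
          (2 * ((Nat.sqrt (Nat.card (Valued.ResidueField (w.1.adicCompletion E))) : ℂ) - 1) *
              ∑ i ∈ Finset.Ico j m, (-1 : ℂ) ^ i * (Nat.sqrt (Nat.card (Valued.ResidueField (w.1.adicCompletion E))) : ℂ) ^ (m - 1 - i)) •
            heckeAlgebra.doubleCosetOperator (k := ℂ) (unitaryInt (galAdicCompletionMap (L := E) c hw) ((StdForm.antidiagonal 2).over (w.1.adicCompletion E)))
              (t ^ j) := by
  haveI := isHeckeTriple_unitaryInt_adicCompletion c v w hw ((StdForm.antidiagonal 2).over (w.1.adicCompletion E))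
  refine (signInvolutionAlgHom_basic_pow c hc1 v w hw hv hd t ht hm).trans (congrArg₂ (· + ·) rfl ?_)
  refine (sum_smul_ball_swap (fun i => 2 * ((Nat.sqrt (Nat.card (Valued.ResidueField (w.1.adicCompletion E))) : ℂ) - 1) * (-1) ^ i *
      (Nat.sqrt (Nat.card (Valued.ResidueField (w.1.adicCompletion E))) : ℂ) ^ (m - 1 - i))
    (fun j => heckeAlgebra.doubleCosetOperator (k := ℂ)
      (unitaryInt (galAdicCompletionMap (L := E) c hw) ((StdForm.antidiagonal 2).over (w.1.adicCompletion E))) (t ^ j)) m).trans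
    (Finset.sum_congr rfl fun j _ => congrArg (· • _) ?_)
  rw [Finset.mul_sum]
  exact Finset.sum_congr rfl fun i _ => by ring

end Basis

end Summit.HodgeConjecture.HodgeConjecture.R90.S6

end
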